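import Summits.QuantumFields.YangMills.Theorems.BalabanUVNodesN15KingModelCovariantLaplacian
import Summits.QuantumFields.YangMills.Theorems.BalabanUVNodesN15KingModelTorusFreeDeterminant
import HarnessLib

/-!
# BalabanUVNodes ∕ N15 — THE KING-MODEL RUNG (PART Ͱ-c): THE COVARIANT GAUSSIAN NORMALISATION IS SQUEEZED, UNIFORMLY IN THE LINK FIELD — the BFS DIAMAGNETIC INEQUALITY BY NAME
# `(det(c(−Δ)+m²))^{|n|} ≤ det(−cΔ_U+m²)` on King's torus, the AM–GM ceiling `det(−cΔ_U+m²) ≤ (m²+2(d+1)c)^{|n||T|}`, hence per site and component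
# `f_T(c,m²) ≤ (|n||T|)⁻¹ln det(−cΔ_U+m²) ≤ ln(m²+2(d+1)c)` at EVERY unitary `U` (Track A, DAG node N15 = NE2; FAN-OUT v1.1 §N15 s3; count-neutral)

HONEST FRAMING.  Count-neutral (cell `pub-ymgap`, seat `pub-ymgap-dag-n15-e` g42; `--supports stmt-QuantumFields-27247 --as helper` = K3ᴬ, KEY MAP v3).  One finite torus at fixed
spacing; King's `A = 0` free energy (PART Ε-k `log_det_lapF`, `freeEnergyDensity_bounds`) is the FLOOR; NOT Bałaban's determinants of `G_k(U)` ([B9] (3.89)-type objects carry the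
averaging penalty, not of this form); NOT a node discharge (N15 of record untouched); nothing continuum ∕ ℝ⁴ ∕ OS ∕ Clay.

THE RESULT.  For every period vector `K` (all `K_μ ≥ 1`), `c ≥ 0`, `m² > 0`, fibre `𝕜ⁿ` (`𝕜 = ℝ` or `ℂ`) and EVERY unitary link field `U`, with `M_U = −cΔ_U + m²` of PART Ͱ-a:
* §1 (generic, Mathlib-only) ★★ **`PosDef.re_det_le_pow`** — AM–GM on the spectrum: a positive definite `A` on `m` has `Re det A ≤ (Re tr A ∕ |m|)^{|m|}`
  (`IsHermitian.det_eq_prod_eigenvalues`, `trace_eq_sum_eigenvalues`, `Real.geom_mean_le_arith_mean_weighted`);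
* §2 `det_covLapF_eq_ofReal_re` (`det M_U` is real), `re_det_covLapF_pos`, ★★★ **`det_lapF_pow_le_re_det_covLapF`** — THE DIAMAGNETIC INEQUALITY ON KING's TORUS BY NAME
  (`LatticeDiamagneticInequality.Hopping.det_coupling_free_le` [BrydgesFrohlichSeiler1979], as invoked at [Balaban1982Higgs2] (3.37)–(3.38) p.591, + Ͱ-a `det_covLapF_free`):
  `(det(c(−Δ)+m²))^{|n|} ≤ Re det M_U` — switching on ANY gauge field can only DECREASE the minimally coupled Gaussian integral `∫e^{−½⟨φ,M_Uφ⟩}dφ ∝ (det M_U)^{−1∕2}` below King's;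
  ★★ **`trace_covLapF`** (`tr M_U = |n||T|(m²+2(d+1)c)` when all `K_μ ≥ 2` — no self-loop bonds), ★★★ **`re_det_covLapF_le_pow`** (`Re det M_U ≤ (m²+2(d+1)c)^{|n||T|}`);
* §3 per site and component: ★★★ **`log_re_det_covLapF_div_bounds`** — `|T|⁻¹ln det(c(−Δ)+m²) ≤ (|n||T|)⁻¹ln Re det M_U ≤ ln(m²+2(d+1)c)`, ★★ **`log_re_det_covLapF_div_ge_log_mass`**
  (`≥ ln m²`, Ε-k `freeEnergyDensity_bounds`), ★ `log_re_det_covLapF_kingGaugeAct` (gauge invariant, Ͱ-a) — the covariant normalisation per degree of freedom lives in a window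
  of width `ln(1 + 2(d+1)c∕m²)` INDEPENDENT of `U` and of the volume, whose floor is King's free energy density.

PRIOR TREE ART (by name): Ͱ-a (`covLapF`, `kingHopping_strictDom`, `posDef_covLapF`, `det_covLapF_free`, `covLapF_apply`, `det_covLapF_kingGaugeAct`), `LatticeDiamagneticInequality.Hopping`
(`det_coupling_free_le`, `im_det_coupling`, `det_coupling_pos`), Ε-k (`det_lapF_pos`, `freeEnergyDensity_bounds`), Mathlib (`Matrix.IsHermitian.eigenvalues`, `Real.geom_mean_le_arith_mean_weighted`).
Dedup (rg at filing): basename 0 files; needles `re_det_le_pow|det_lapF_pow_le_re_det_covLapF|re_det_covLapF_le_pow|trace_covLapF|log_re_det_covLapF` 0 tree files.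
Locators: [Balaban1982Higgs2] (3.37)–(3.38) p.591; [King1986] (3.89) p.668, (4.4) p.670; [Balaban1985BackgroundPropagators] (3.23) p.394, p.398 l.1–2.  0 `sorry`, 0 `def`.
-/

noncomputable section

open scoped BigOperators ComplexConjugate ComplexOrder Kronecker
open Finset Matrix

namespace Summit.QuantumFields.YangMills.BalabanUVNodes.N15KingModelRung.Covariant

open Literature.MathematicalPhysics.QuantumFieldTheory.LatticeDiamagneticInequality (Hopping blk placed)
open Literature.MathematicalPhysics.QuantumFieldTheory.Balaban1983to89.B5Prop11Plancherel (Tor unitVec)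
open Literature.MathematicalPhysics.QuantumFieldTheory.King1986.Torus (lapF)
open Summit.QuantumFields.YangMills.BalabanUVNodes.N15KingModelRung.TorusSpectral (det_lapF_pos freeEnergyDensity_bounds)

variable {d : ℕ} (K : Fin (d + 1) → ℕ)

/-! ## §1 AM–GM on the spectrum of a positive definite matrix -/

section AMGM

variable {𝕜 : Type*} [RCLike 𝕜] {m : Type*} [Fintype m] [DecidableEq m]

/-- The real part of the determinant of a Hermitian matrix is the product of its eigenvalues. [folklore] -/
theorem IsHermitian.re_det_eq_prod_eigenvalues {A : Matrix m m 𝕜} (hA : A.IsHermitian) : RCLike.re A.det = ∏ i, hA.eigenvalues i := by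
  rw [hA.det_eq_prod_eigenvalues, ← RCLike.ofReal_prod, RCLike.ofReal_re]

/-- The real part of the trace of a Hermitian matrix is the sum of its eigenvalues. [folklore] -/
theorem IsHermitian.re_trace_eq_sum_eigenvalues {A : Matrix m m 𝕜} (hA : A.IsHermitian) : RCLike.re A.trace = ∑ i, hA.eigenvalues i := by
  rw [hA.trace_eq_sum_eigenvalues, ← RCLike.ofReal_sum, RCLike.ofReal_re]

/-- ★★ **AM–GM ON THE SPECTRUM**: a positive definite matrix `A` on a finite index type `m` satisfies `Re det A ≤ (Re tr A ∕ |m|)^{|m|}` (the geometric mean of the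
(positive) eigenvalues is at most their arithmetic mean). [folklore] -/
theorem PosDef.re_det_le_pow {A : Matrix m m 𝕜} (hA : A.PosDef) :
    RCLike.re A.det ≤ (RCLike.re A.trace / Fintype.card m) ^ Fintype.card m := by
  rcases isEmpty_or_nonempty m with hm | hm
  · have h0 : Fintype.card m = 0 := Fintype.card_eq_zero
    rw [h0, pow_zero, Matrix.det_isEmpty, RCLike.one_re]
  have hNpos : (0 : ℝ) < Fintype.card m := by exact_mod_cast Fintype.card_pos
  set ev := hA.1.eigenvalues with hev
  have hpos : ∀ i, 0 < ev i := fun i => hA.eigenvalues_pos i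
  rw [IsHermitian.re_det_eq_prod_eigenvalues hA.1, IsHermitian.re_trace_eq_sum_eigenvalues hA.1]
  -- AM–GM with equal weights `1∕N`
  have hw := Real.geom_mean_le_arith_mean_weighted (Finset.univ : Finset m) (fun _ => (Fintype.card m : ℝ)⁻¹) ev (fun _ _ => by positivity)
    (by rw [Finset.sum_const, Finset.card_univ, nsmul_eq_mul, mul_inv_cancel₀ hNpos.ne']) (fun i _ => (hpos i).le)
  rw [Real.finsetProd_rpow _ _ (fun i _ => (hpos i).le), ← Finset.mul_sum] at hw
  have hprod : 0 ≤ ∏ i, ev i := Finset.prod_nonneg fun i _ => (hpos i).le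
  have hraise := pow_le_pow_left₀ (Real.rpow_nonneg hprod _) hw (Fintype.card m)
  rw [← Real.rpow_natCast, ← Real.rpow_mul hprod, inv_mul_cancel₀ hNpos.ne', Real.rpow_one] at hraise
  simpa only [div_eq_inv_mul] using hraise

end AMGM

/-! ## §2 The diamagnetic floor and the AM–GM ceiling for `det(−cΔ_U+m²)` -/

section Determinant

variable {𝕜 : Type*} [RCLike 𝕜] {n : Type*} [Fintype n] [DecidableEq n]
variable [hK : ∀ μ, NeZero (K μ)] {c m2 : ℝ}

/-- `det M_U` is REAL (Hermitian with positive spectrum): `det M_U = Re det M_U`. [cite: Balaban1982Higgs2, (3.38) p.591] -/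
theorem det_covLapF_eq_ofReal_re (hc : 0 ≤ c) (hm : 0 < m2) (U : Tor K × Fin (d + 1) → Matrix n n 𝕜) :
    (covLapF K c m2 U).det = ((RCLike.re (covLapF K c m2 U).det : ℝ) : 𝕜) := by
  refine (RCLike.re_add_im _).symm.trans ?_
  rw [show RCLike.im (covLapF K c m2 U).det = 0 from (kingHopping K c m2).im_det_coupling (kingHopping_strictDom K hc hm) U]
  simp

/-- `0 < Re det M_U` for every unitary link field. [cite: Balaban1982Higgs2, (3.38) p.591] -/
theorem re_det_covLapF_pos (hc : 0 ≤ c) (hm : 0 < m2) {U : Tor K × Fin (d + 1) → Matrix n n 𝕜} (hU : ∀ b, U b ∈ Matrix.unitaryGroup n 𝕜) :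
    0 < RCLike.re (covLapF K c m2 U).det :=
  RCLike.pos_iff.mp ((kingHopping K c m2).det_coupling_pos (kingHopping_strictDom K hc hm) hU) |>.1

/-- ★★★ **THE DIAMAGNETIC INEQUALITY ON KING's TORUS, BY NAME**: `(det(c(−Δ)+m²))^{|n|} ≤ Re det(−cΔ_U+m²)` for EVERY unitary link field `U` (`c ≥ 0`, `m² > 0`; every period
vector, every fibre) — the tree's `LatticeDiamagneticInequality.Hopping.det_coupling_free_le` ([BrydgesFrohlichSeiler1979]; invoked by Bałaban at [Balaban1982Higgs2] (3.37)–(3.38)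
p.591 to bound the last covariant Gaussian integral by `exp E_{0,s}`) under the King datum's strict dominance, with the free determinant identified by Ͱ-a `det_covLapF_free`:
switching on ANY gauge field lowers the minimally coupled Gaussian integral `∝ (det M_U)^{−1∕2}` below King's `A = 0` value. [cite: Balaban1982Higgs2, (3.38) p.591; King1986, (3.89) p.668] -/
theorem det_lapF_pow_le_re_det_covLapF (hc : 0 ≤ c) (hm : 0 < m2) {U : Tor K × Fin (d + 1) → Matrix n n 𝕜} (hU : ∀ b, U b ∈ Matrix.unitaryGroup n 𝕜) :
    (lapF K c m2).det ^ Fintype.card n ≤ RCLike.re (covLapF K c m2 U).det := by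
  have h := (kingHopping K c m2).det_coupling_free_le (𝕜 := 𝕜) (n := n) (kingHopping_strictDom K hc hm) hU
  have hfree : RCLike.re ((kingHopping K c m2).coupling (Hopping.free : Tor K × Fin (d + 1) → Matrix n n 𝕜)).det = (lapF K c m2).det ^ Fintype.card n := by
    rw [show (kingHopping K c m2).coupling (Hopping.free : Tor K × Fin (d + 1) → Matrix n n 𝕜) = covLapF K c m2 Hopping.free from rfl, det_covLapF_free,
      ← RCLike.ofReal_pow, RCLike.ofReal_re]
  rwa [hfree] at h

/-- ★★ **THE TRACE**: `tr(−cΔ_U+m²) = |n|·|T|·(m²+2(d+1)c)` for every link field, when every period is `≥ 2` (no bond is a self-loop, so the hopping matrix has zero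
diagonal). [cite: Balaban1985BackgroundPropagators, (3.23) p.394; King1986, (4.4) p.670] -/
theorem trace_covLapF (hK2 : ∀ μ, 1 < K μ) (c m2 : ℝ) (U : Tor K × Fin (d + 1) → Matrix n n 𝕜) :
    (covLapF K c m2 U).trace = (Fintype.card (Tor K × n) : 𝕜) * ((m2 + 2 * ((d : ℝ) + 1) * c : ℝ) : 𝕜) := by
  have hne : ∀ μ : Fin (d + 1), unitVec K μ ≠ 0 := fun μ h => by
    have := congr_fun h μ
    simp only [unitVec, Pi.single_eq_same, Pi.zero_apply] at this
    exact absurd this (by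
      haveI : Fact (1 < K μ) := ⟨hK2 μ⟩
      exact one_ne_zero)
  rw [Matrix.trace]
  calc ∑ p : Tor K × n, (covLapF K c m2 U).diag p = ∑ _p : Tor K × n, (((m2 + 2 * ((d : ℝ) + 1) * c : ℝ) : 𝕜)) := by
        refine Finset.sum_congr rfl fun p _ => ?_
        obtain ⟨x, i⟩ := p
        rw [Matrix.diag_apply, covLapF_apply]
        simp only [and_self, if_true]
        have h1 : ∀ μ, ¬ (x = x + unitVec K μ) := fun μ h => hne μ (left_eq_add.mp h)
        have h2 : ∀ μ, ¬ (x = x - unitVec K μ) := fun μ h => hne μ (by rw [sub_eq_add_neg] at h; exact neg_eq_zero.mp (left_eq_add.mp h))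
        simp only [h1, h2, if_false, add_zero, Finset.sum_const_zero, mul_zero, sub_zero]
    _ = (Fintype.card (Tor K × n) : 𝕜) * ((m2 + 2 * ((d : ℝ) + 1) * c : ℝ) : 𝕜) := by
        rw [Finset.sum_const, Finset.card_univ, nsmul_eq_mul]

/-- ★★★ **THE AM–GM CEILING**: `Re det(−cΔ_U+m²) ≤ (m²+2(d+1)c)^{|T|·|n|}` for EVERY unitary link field (all periods `≥ 2`; `c ≥ 0`, `m² > 0`).
[cite: Balaban1985BackgroundPropagators, (3.23) p.394; King1986, (3.89) p.668] -/
theorem re_det_covLapF_le_pow (hK2 : ∀ μ, 1 < K μ) (hc : 0 ≤ c) (hm : 0 < m2) {U : Tor K × Fin (d + 1) → Matrix n n 𝕜}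
    (hU : ∀ b, U b ∈ Matrix.unitaryGroup n 𝕜) :
    RCLike.re (covLapF K c m2 U).det ≤ (m2 + 2 * ((d : ℝ) + 1) * c) ^ Fintype.card (Tor K × n) := by
  have h := PosDef.re_det_le_pow (posDef_covLapF K hc hm hU)
  rw [trace_covLapF K hK2 c m2 U, ← RCLike.ofReal_natCast, ← RCLike.ofReal_mul, RCLike.ofReal_re] at h
  have hN : (0 : ℝ) < Fintype.card (Tor K × n) ∨ Fintype.card (Tor K × n) = 0 := by
    rcases Nat.eq_zero_or_pos (Fintype.card (Tor K × n)) with h0 | h0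
    · exact Or.inr h0
    · exact Or.inl (by exact_mod_cast h0)
  rcases hN with hN | hN
  · rwa [mul_div_cancel_left₀ _ hN.ne'] at h
  · rw [hN, pow_zero] at h ⊢
    exact h

end Determinant

/-! ## §3 Per site and component: the covariant normalisation is squeezed, uniformly in `U` -/

section PerSite

variable {𝕜 : Type*} [RCLike 𝕜] {n : Type*} [Fintype n] [DecidableEq n] [Nonempty n]
variable [hK : ∀ μ, NeZero (K μ)] {c m2 : ℝ}

/-- ★★★ **THE WINDOW**: for EVERY unitary link field `U` (all periods `≥ 2`, `c ≥ 0`, `m² > 0`), per site and per component,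
`|T|⁻¹ln det(c(−Δ)+m²) ≤ (|n||T|)⁻¹ln Re det(−cΔ_U+m²) ≤ ln(m²+2(d+1)c)` — floor = King's `A = 0` free energy density (diamagnetism), ceiling = AM–GM; the window does not depend on
`U` nor on the volume. [cite: Balaban1982Higgs2, (3.38) p.591; King1986, (3.89)–(3.93) pp.668–669] -/
theorem log_re_det_covLapF_div_bounds (hK2 : ∀ μ, 1 < K μ) (hc : 0 ≤ c) (hm : 0 < m2) {U : Tor K × Fin (d + 1) → Matrix n n 𝕜}
    (hU : ∀ b, U b ∈ Matrix.unitaryGroup n 𝕜) :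
    (Fintype.card (Tor K) : ℝ)⁻¹ * Real.log (lapF K c m2).det
        ≤ (Fintype.card (Tor K × n) : ℝ)⁻¹ * Real.log (RCLike.re (covLapF K c m2 U).det) ∧
      (Fintype.card (Tor K × n) : ℝ)⁻¹ * Real.log (RCLike.re (covLapF K c m2 U).det) ≤ Real.log (m2 + 2 * ((d : ℝ) + 1) * c) := by
  have hT : (0 : ℝ) < Fintype.card (Tor K) := by exact_mod_cast Fintype.card_pos
  have hn : (0 : ℝ) < Fintype.card n := by exact_mod_cast Fintype.card_pos
  have hTn : (Fintype.card (Tor K × n) : ℝ) = Fintype.card (Tor K) * Fintype.card n := by rw [Fintype.card_prod]; push_cast; ring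
  have hdet : 0 < (lapF K c m2).det := det_lapF_pos K hc hm
  have hre : 0 < RCLike.re (covLapF K c m2 U).det := re_det_covLapF_pos K hc hm hU
  have hM : 0 < m2 + 2 * ((d : ℝ) + 1) * c := by positivity
  constructor
  · -- floor: `|n| ln det lapF ≤ ln Re det M_U`
    have h1 := Real.log_le_log (pow_pos hdet _) (det_lapF_pow_le_re_det_covLapF K hc hm hU)
    rw [Real.log_pow] at h1
    rw [hTn, mul_inv, mul_assoc]
    refine mul_le_mul_of_nonneg_left ?_ (inv_nonneg.2 hT.le)
    rwa [le_inv_mul_iff₀ hn]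
  · -- ceiling: `ln Re det M_U ≤ |T×n| ln(m²+2(d+1)c)`
    have h2 := Real.log_le_log hre (re_det_covLapF_le_pow K hK2 hc hm hU)
    rw [Real.log_pow] at h2
    have hTn' : (0 : ℝ) < Fintype.card (Tor K × n) := by rw [hTn]; positivity
    rwa [inv_mul_le_iff₀ hTn']

/-- ★★ **THE MASS FLOOR**: `ln m² ≤ (|n||T|)⁻¹ln Re det(−cΔ_U+m²)` at every unitary `U` (Ε-k `freeEnergyDensity_bounds` under the diamagnetic floor).
[cite: King1986, (3.89) p.668; Balaban1982Higgs2, (3.38) p.591] -/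
theorem log_re_det_covLapF_div_ge_log_mass (hK2 : ∀ μ, 1 < K μ) (hc : 0 ≤ c) (hm : 0 < m2) {U : Tor K × Fin (d + 1) → Matrix n n 𝕜}
    (hU : ∀ b, U b ∈ Matrix.unitaryGroup n 𝕜) :
    Real.log m2 ≤ (Fintype.card (Tor K × n) : ℝ)⁻¹ * Real.log (RCLike.re (covLapF K c m2 U).det) :=
  ((freeEnergyDensity_bounds K hc hm).1).trans (log_re_det_covLapF_div_bounds K hK2 hc hm hU).1

omit [Nonempty n] in
/-- ★ GAUGE INVARIANCE of the covariant normalisation: `ln Re det M_{U^g} = ln Re det M_U` (Ͱ-a `det_covLapF_kingGaugeAct`). [cite: Balaban1985BackgroundPropagators, p.398 l.1–2] -/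
theorem log_re_det_covLapF_kingGaugeAct (c m2 : ℝ) {g : Tor K → Matrix n n 𝕜} (hg : ∀ x, g x ∈ Matrix.unitaryGroup n 𝕜)
    (U : Tor K × Fin (d + 1) → Matrix n n 𝕜) :
    Real.log (RCLike.re (covLapF K c m2 (kingGaugeAct K g U)).det) = Real.log (RCLike.re (covLapF K c m2 U).det) := by
  rw [det_covLapF_kingGaugeAct K c m2 hg U]

/-- ★★ **THE WINDOW's WIDTH**: the covariant normalisation per degree of freedom varies over ALL unitary link fields by at most `ln(m²+2(d+1)c) − |T|⁻¹ln det(c(−Δ)+m²)`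
`≤ ln(1 + 2(d+1)c∕m²)` — uniformly in `U` and in the volume. [cite: Balaban1982Higgs2, (3.38) p.591; King1986, (3.89)–(3.93) pp.668–669] -/
theorem log_re_det_covLapF_div_sub_le (hK2 : ∀ μ, 1 < K μ) (hc : 0 ≤ c) (hm : 0 < m2) {U V : Tor K × Fin (d + 1) → Matrix n n 𝕜}
    (hU : ∀ b, U b ∈ Matrix.unitaryGroup n 𝕜) (hV : ∀ b, V b ∈ Matrix.unitaryGroup n 𝕜) :
    (Fintype.card (Tor K × n) : ℝ)⁻¹ * Real.log (RCLike.re (covLapF K c m2 U).det)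
        - (Fintype.card (Tor K × n) : ℝ)⁻¹ * Real.log (RCLike.re (covLapF K c m2 V).det)
      ≤ Real.log (1 + 2 * ((d : ℝ) + 1) * c / m2) := by
  have hU' := (log_re_det_covLapF_div_bounds K hK2 hc hm hU).2
  have hV' := ((freeEnergyDensity_bounds K hc hm).1).trans (log_re_det_covLapF_div_bounds K hK2 hc hm hV).1
  have hlog : Real.log (m2 + 2 * ((d : ℝ) + 1) * c) - Real.log m2 = Real.log (1 + 2 * ((d : ℝ) + 1) * c / m2) := by
    rw [← Real.log_div (by positivity) hm.ne']
    congr 1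
    field_simp
  linarith

end PerSite

end Summit.QuantumFields.YangMills.BalabanUVNodes.N15KingModelRung.Covariant

end
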